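import Summits.QuantumFields.YangMills.Theorems.BalabanUVNodesN06TbHLegAtPinsPhysPU
import Summits.QuantumFields.YangMills.Theorems.BalabanUVNodesN06CutLettersPinsPrintAtRecord
import Literature.MathematicalPhysics.QuantumFieldTheory.Balaban1983to89.B9Thm313WholeHolderProducersAtPinsPrint
import Summits.QuantumFields.YangMills.Theorems.BalabanUVNodesN06DgLegAtPinsPhysPU
import Literature.MathematicalPhysics.QuantumFieldTheory.Balaban1983to89.B9RWSums347DefiniteFaces
import Literature.MathematicalPhysics.QuantumFieldTheory.Balaban1983to89.B9RowSum261DefiniteFaces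
import Literature.MathematicalPhysics.QuantumFieldTheory.Balaban1983to89.B9PerturbationMajorantsAtLettersPhys
import Literature.MathematicalPhysics.QuantumFieldTheory.Balaban1983to89.B9GradViaDivLettersTransported
import Literature.MathematicalPhysics.QuantumFieldTheory.Balaban1983to89.B9BackgroundsKLevelV1R
import Literature.MathematicalPhysics.QuantumFieldTheory.Balaban1983to89.B9GeoLemma21KLevelV1
import Literature.MathematicalPhysics.QuantumFieldTheory.Balaban1983to89.B9PinMembersKLevelV1
import Literature.MathematicalPhysics.QuantumFieldTheory.Balaban1983to89.B9LettersHZAtOne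
import Literature.MathematicalPhysics.QuantumFieldTheory.Balaban1983to89.B9CoReadingCoordsHolderAdm

/-!
# CASCADE-K «K3-D» (director-ym №383) — THE SITE-TRANSPORTER-PARAMETRIC RE-PRESS of `N06TbHLegAtPinsPhysPU`: `htbH_of_pinsP43_geo9Y_par` = the landed `htbH_of_pinsP43_geo9Y` VERBATIM with the record's symmetric site transporter `parSymY x.toKIdx` replaced by a PARAMETER `parT : ∀ i, SiteParY _ i` (every `GpY ∕ GpPhysY ∕ TpicoK ∕ T2coK ∕ RcoK …` letter read at `parT x.toKIdx`; proofs verbatim — the callees are transporter-generic or their landed `_par` twins are called).  At `parT := fun i => parSymY i` these ARE the originals; at the knit transporter they serve the knit certificate's Sect.-D network «KD» (dag-n06-d g25∕g26, HOME `K3D-CENSUS-g25.md`).  Seat `pub-ymgap-dag-n06-d` (g26), 2026-08-30.  The original module text below applies word for word otherwise.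
#

# BalabanUVNodes ∕ N06 ([B9], `Dag.B9_main`) — THE T_b-LETTER OF Δ′_π ALONE INTO `bH13 x U` (`Letters3131H.tbH` ∕ `LettersS3131.tbH`'s raw input), DERIVED ABOVE A CLOSED
# THRESHOLD AT THE PRINT-WEIGHTED PIN (P2′), PRINT'S ROUTE — the Δ⁽²⁾-FREE HALF of `BalabanUVNodesN06L3131HLegAtPinsPhysPU.hL3131H_of_pinsP43_geo9Y` (U8 cure, step 0)

Track A of `YM-PLAN.md` (cell `pub-ymgap`, HUMAN RULING D-0062), node **N06** = [Balaban1985BackgroundPropagators] Thms 3.1–3.15; seat `pub-ymgap-dag-n06-d`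
(gen 18).  WHY (director-ym №272 (5), FLAG №8 (U8); dag-n06-l LOCATED-U8): the U8 cure re-leafs rows 20–21 on dag-n06-l's S-leaves, whose perturbation step reads the
letters out of a REGULAR STATE class; the state letters at the pins (`BalabanUVNodesN06LettersSAtPinsPU.hLettersS_of_pinsP44_geo9Y`) take the RAW letter
`htbH : T_b : 𝔠⁽²⁾ → bH13 x U` as input.  In the certificate of record that letter comes out of `hL3131H_of_pinsP43_geo9Y` TOGETHER WITH `T_b₂ = −(RG′∇*)∘T_a₂`, whose input is the
raw Δ⁽²⁾ letter `hta₂` — the very display the cure removes.  THIS FILE separates the Δ⁽²⁾-free half: `T_b = RG′B† − (RG′∇*)∘T_a` INTO `bH13 x U` from the SAME Thm-3.1 (3.43)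
display `h43` for G′∇*_U, Theorem 3.1 (`h31`), (3.49) (`h49`), the current letters `hBJ` and the T_a letter `hta` ONLY — dag-n06-l's
`B9Thm313WholeHolderProducersAtPinsPrint.tbH_pins_print_of_h43` (p690516) at the members, with `Facts347` at `(α := 1∕2, δF := 2·τ)`, `RowSum` at `σ` (`rowConst261`),
`hU := links_le_one hGR`, `hcf := abs_cf_eq_nKT x.hcfk`, the member's `L ≤ ℓ+1` moved into the closed constant by `CTel_mono`:
★★ `htbH_of_pinsP43_geo9Y : ∃ MT, ∀ x, MT ≤ M → … → (hBJ hta at x, α₀, U — member-wise AFTER the threshold) → HasMaj 𝔠⁽²⁾ (bH13 x U) (TbLcoKH …) (t₂·((geo9Y x).M·α₀)·e^{−ρd})`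
for every displayed `t₂ ≥ KH₀` — the SAME closed `KH₀` and hypothesis `ht₂` as `hL3131H_of_pinsP43_geo9Y` (so the certificate's `tT2` discharges it verbatim; the T_b constant is
its first summand).
HONEST FRAMING.  Kernel bookkeeping (∃-packaging of a landed Literature theorem with landed member-fact theorems); `h43`, `hBJ`, `hta`, `h31`, `h49` are HYPOTHESES of printed
species; NO Δ⁽²⁾ letter enters; nothing of [B9] asserted; COUNT-NEUTRAL; N06 NOT discharged; K1⁹ NOT closed; one finite 𝕋⁴ programme at fixed `ε` — NOT continuum ∕ OS ∕
mass gap ∕ Clay.  0 `def`, 0 `sorry`.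
-/

noncomputable section

namespace Summit.QuantumFields.YangMills.BalabanUVNodes.N06TbHLegAtPinsPhysPUPar

open Literature.MathematicalPhysics.QuantumFieldTheory.Balaban1983to89
open Literature.MathematicalPhysics.QuantumFieldTheory.Balaban1983to89.Node00 (FBondY IBondY SiteY CfgY SiteParY SiteOpY BondParY parSymY parBY GpY GpPhysY)
open Literature.MathematicalPhysics.QuantumFieldTheory.Balaban1983to89.Node00.OpsYSectDCoords (DvcoKH DvscoKH RcoK cR39_trBasis_pos)
open Literature.MathematicalPhysics.QuantumFieldTheory.Balaban1983to89.B9Thm39ReadingCoords (cR39)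
open Literature.MathematicalPhysics.QuantumFieldTheory.Balaban1983to89.B9Thm34Ext (toB6)
open Literature.MathematicalPhysics.QuantumFieldTheory.Balaban1983to89.B11SectG (HasMaj BlockNorm RowSum)
open Literature.MathematicalPhysics.QuantumFieldTheory.Balaban1983to89.B9Thm312Whole (cNorm GeoOK)
open Literature.MathematicalPhysics.QuantumFieldTheory.Balaban1983to89.B9Thm312WholeClasses (cNormR)
open Literature.MathematicalPhysics.QuantumFieldTheory.Balaban1983to89.B9RWSums343Holder (HolderProbes)
open Literature.MathematicalPhysics.QuantumFieldTheory.Balaban1983to89.B9RWSums343to347Whole (Facts347)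
open Literature.MathematicalPhysics.QuantumFieldTheory.Balaban1983to89.B9CoReadingCoords (XBK blkBK)
open Literature.MathematicalPhysics.QuantumFieldTheory.Balaban1983to89.B9CoReadingCoordsS (XSK sIK blkSK GcoS)
open Literature.MathematicalPhysics.QuantumFieldTheory.Balaban1983to89.B9CoReadingCoordsH (XHK)
open Literature.MathematicalPhysics.QuantumFieldTheory.Balaban1983to89.B9CoReadingCoordsHolder (PK)
open Literature.MathematicalPhysics.QuantumFieldTheory.Balaban1983to89.B9CoReadingCoordsTranspose (TrIdx trBasis)
open Literature.MathematicalPhysics.QuantumFieldTheory.Balaban1983to89.B9PinMembersKLevelV1 (MemberY geo9Y)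
open Literature.MathematicalPhysics.QuantumFieldTheory.Balaban1983to89.B9BackgroundsKLevelV1R (RegFamY bg9YR MemOfFam)
open Literature.MathematicalPhysics.QuantumFieldTheory.Balaban1983to89.B9GeoLemma21KLevelV1 (geo9Y_len_pos geo9Y_dist_triangle geo9Y_dist_comm)
open Literature.MathematicalPhysics.QuantumFieldTheory.Balaban1983to89.B9GeoNormsKLevelV1 (geo9K geo9K_dist_nonneg)
open Literature.MathematicalPhysics.QuantumFieldTheory.Balaban1983to89.B7Prop2SpecialUnitary (specialUnitaryUnits)
open Literature.MathematicalPhysics.QuantumFieldTheory.Balaban1983to89.B9PerturbationMajorantAlgebra (Proj349Maj)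
open Literature.MathematicalPhysics.QuantumFieldTheory.Balaban1983to89.B9PerturbationMajorantsAtLetters (PcoK rcoK_eq)
open Literature.MathematicalPhysics.QuantumFieldTheory.Balaban1983to89.B9PerturbationMajorantsAtLettersPhys (rcoK_GpPhysY)
open Literature.MathematicalPhysics.QuantumFieldTheory.Balaban1983to89.B9MultiscaleSmoothPartitionYNear (rNear)
open Literature.MathematicalPhysics.QuantumFieldTheory.Balaban1983to89.B9SmoothHolderClassP (bHZKP bHZKPG)
open Literature.MathematicalPhysics.QuantumFieldTheory.Balaban1983to89.B9GradViaDivLettersTransported (taxiB)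
open Literature.MathematicalPhysics.QuantumFieldTheory.Balaban1983to89.B9Thm313WholeHolderProducersAtPinsPrint (tbH_pins_print_of_h43)
open Literature.MathematicalPhysics.QuantumFieldTheory.Balaban1983to89.B9PerturbationMajorantAlgebra (CurrentMaj)
open Literature.MathematicalPhysics.QuantumFieldTheory.Balaban1983to89.B9PerturbationMajorantsAtLetters (BcoKH BdcoKH)
open Literature.MathematicalPhysics.QuantumFieldTheory.Balaban1983to89.B9PerturbationSplitAtLetters (TaLcoK TbLcoKH)
open Literature.MathematicalPhysics.QuantumFieldTheory.Balaban1983to89.B9SmoothHolderClassPProducers (CTel CTel_nonneg CTel_mono)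
open Literature.MathematicalPhysics.QuantumFieldTheory.Balaban1983to89.B9PerturbationMajorantAlgebra (hasMaj_weaken)
open Literature.MathematicalPhysics.QuantumFieldTheory.Balaban1983to89.B9Thm313WholeRgdFrom3152 (Ids3152)
open Literature.MathematicalPhysics.QuantumFieldTheory.Balaban1983to89.B9SmoothHolderClassP (bHZPG)
open Literature.MathematicalPhysics.QuantumFieldTheory.Balaban1983to89.B9GradViaDivLettersTransported (taxiS)
open Literature.MathematicalPhysics.QuantumFieldTheory.Balaban1983to89.B9SmoothHolderClassTClosure (abs_cf_eq_nKT)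
open Literature.MathematicalPhysics.QuantumFieldTheory.Balaban1983to89.B9RWSums347DefiniteFaces (geo9Y_scalars)
open Summit.QuantumFields.YangMills.BalabanUVNodes.N06HolderPinsGradedAtRecord (links_le_one)
open B6Prop22KLevelTorusCensusEta (nKT) open Literature.MathematicalPhysics.QuantumFieldTheory.Balaban1983to89.Node00 (toKT)
open Literature.MathematicalPhysics.QuantumFieldTheory.Balaban1983to89.B9RWSums347DefiniteFaces (exp261 facts347_exp261_geo9Y)
open Literature.MathematicalPhysics.QuantumFieldTheory.Balaban1983to89.B9RowSum261DefiniteFaces (rowConst261 rowConst261_nonneg rowConst261_spec_of_rowSum261)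
open Literature.MathematicalPhysics.QuantumFieldTheory.Balaban1983to89.B9GeoLemma21KLevelV1 (rowSum261_geo9Y)
open Literature.MathematicalPhysics.QuantumFieldTheory.Balaban1983to89.B9SectDSup (weightNorm)
open Literature.MathematicalPhysics.QuantumFieldTheory.Balaban1983to89.B6RandomWalkHom (HasMajorantHom)
open Literature.MathematicalPhysics.QuantumFieldTheory.Balaban1983to89.B9Thm313WholeLettersCut (Letters313Zc)
open Literature.MathematicalPhysics.QuantumFieldTheory.Balaban1983to89.B9PerturbationMajorantAlgebra (Thm31GpMaj)
open Literature.MathematicalPhysics.QuantumFieldTheory.Balaban1983to89.B9Thm312Whole (Identities)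
open Literature.MathematicalPhysics.QuantumFieldTheory.Balaban1983to89.B9CoReadingCoordsHolder (blkPK probeK wK w₀K)
open Literature.MathematicalPhysics.QuantumFieldTheory.Balaban1983to89.B9CoReadingCoordsHolderAdm (wKA holderProbesKA)
open Literature.MathematicalPhysics.QuantumFieldTheory.Balaban1983to89.B9LettersHZAtOne (plateau_pos)
open B6GlobalChartV1 (PV blkV1) open B6Ineq2142KLevelV1 (β lvl) open B6Geom246MultiLevelTorus (geomT)
open scoped Matrix.Norms.L2Operator

variable {N : ℕ} {d ℓ : ℕ} {hd : 1 ≤ d + 1} {hL : Odd (ℓ + 1) ∧ 1 < ℓ + 1} {b₀ b₁ : ℝ} {Mstar : ℕ}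

/-- ★★ **THE T_b LETTER INTO `bH13 x U` DERIVED ABOVE A CLOSED THRESHOLD AT THE PRINT-WEIGHTED PIN (P2′), PRINT'S ROUTE, NO Δ⁽²⁾ INPUT** (module docstring). [cite: Balaban1985BackgroundPropagators, (3.130)–(3.131) pp.421–422 + (3.135)–(3.137) pp.422–423 + Thm 3.1 (3.42)–(3.43) pp.397–398 + (3.49) p.399 + (3.152) p.426; Balaban1984PropagatorsII, (2.51)–(2.56) pp.232–233 + Lemma 2.1 (2.59)–(2.61) pp.233–234] -/
theorem htbH_of_pinsP43_geo9Y_par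
    (parT : ∀ i : B6KLevelCensusIndexV1.KIdx d ℓ hd hL b₀ b₁, Node00.SiteParY (Matrix (Fin N) (Fin N) ℂ) i) [NeZero N] [∀ x : MemberY d ℓ hd hL b₀ b₁ Mstar, Fintype (geo9Y x).Site]
    {R₁ R₂ : RegFamY d ℓ hd hL b₀ b₁ Mstar (Matrix (Fin N) (Fin N) ℂ)} (H : MemberY d ℓ hd hL b₀ b₁ Mstar → Prop)
    (bI : ∀ x : MemberY d ℓ hd hL b₀ b₁ Mstar, FBondY x.toKIdx → IBondY x.toKIdx)
    (hlev : ∀ (x : MemberY d ℓ hd hL b₀ b₁ Mstar) (f : FBondY x.toKIdx), lvl x.hN x.D x.hk (bI x f) = (blkV1 x.hN x.D f).1.1)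
    (hβ1 : ∀ (x : MemberY d ℓ hd hL b₀ b₁ Mstar) (f : FBondY x.toKIdx), (geomT x.D).dist (β x.hN x.D x.hk (bI x f)) (blkV1 x.hN x.D f) ≤ 1)
    (hGR : MemOfFam (specialUnitaryUnits (Fin N)) R₁) (c : ℝ) {M₀ a₀ : ℝ} (hM₀ : 0 ≤ M₀) {σ τ : ℝ} (hσ : 0 < σ) (hτ : 0 < τ)
    (w13 : ℝ → ℝ) (hw13₀ : ∀ s, 0 ≤ w13 s) (hw13₁ : ∀ s, w13 s ≤ 1)
    (bH13 : ∀ x : MemberY d ℓ hd hL b₀ b₁ Mstar, (bg9YR (Matrix (Fin N) (Fin N) ℂ) (specialUnitaryUnits (Fin N)) R₁ R₂ x).Cfg → BlockNorm (toB6 (geo9Y x) 1 (H x)) (XSK (TrIdx N) x.toKIdx → ℝ))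
    (hbH13 : ∀ (x : MemberY d ℓ hd hL b₀ b₁ Mstar) (U : (bg9YR (Matrix (Fin N) (Fin N) ℂ) (specialUnitaryUnits (Fin N)) R₁ R₂ x).Cfg), bH13 x U =
      letI : Fintype (geo9K x.toKIdx).Site := (inferInstance : Fintype (geo9Y x).Site);
      bHZPG (κ := TrIdx N) x.toKIdx (trBasis N) (taxiS x.toKIdx (bg9YR (Matrix (Fin N) (Fin N) ℂ) (specialUnitaryUnits (Fin N)) R₁ R₂ x) (fun U => U) U) (R := (1 : ℝ)) (H := H x) w13 hw13₀ hw13₁)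
    (𝔬12 : ∀ x : MemberY d ℓ hd hL b₀ b₁ Mstar, B9Thm312Whole.Ops (geo9Y x) (bg9YR (Matrix (Fin N) (Fin N) ℂ) (specialUnitaryUnits (Fin N)) R₁ R₂ x) (XBK (TrIdx N) x.toKIdx) (XBK (TrIdx N) x.toKIdx) (XHK (TrIdx N) x.toKIdx) (XSK (TrIdx N) x.toKIdx))
    (hblk12 : ∀ x : MemberY d ℓ hd hL b₀ b₁ Mstar, (𝔬12 x).blk = blkBK x.toKIdx (bI x))
    (hblkW12 : ∀ x : MemberY d ℓ hd hL b₀ b₁ Mstar, (𝔬12 x).blkW = blkSK x.toKIdx (sIK x.toKIdx (bI x)))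
    {B₀ δ₀ CP δP tJ δB B43 δ43 tA δT r ρ : ℝ} (hB₀ : 0 ≤ B₀) (hCP : 0 ≤ CP) (htJ : 0 ≤ tJ) (hB43 : 0 ≤ B43) (htA : 0 ≤ tA)
    (hr₀ : r ≤ δ₀) (hrP : r ≤ δP) (hrB : r ≤ δB) (hρ : 0 ≤ ρ) (hρT : ρ ≤ δT) (hbud : ρ + σ + τ ≤ r) (hbud43 : ρ + σ ≤ δ43) {t₂ : ℝ}
    (ht₂ : ((CTel d ℓ (trBasis N) ρ (B₀ * (((ℓ + 1 : ℕ) : ℝ)) * ((cR39 (trBasis N))⁻¹ * (tJ * (((ℓ + 1 : ℕ) : ℝ)) ^ 2)) * rowConst261 (@geo9Y d ℓ hd hL b₀ b₁ Mstar) σ) (B₀ * (((ℓ + 1 : ℕ) : ℝ)) * ((cR39 (trBasis N))⁻¹ * (tJ * (((ℓ + 1 : ℕ) : ℝ)) ^ 2)) * rowConst261 (@geo9Y d ℓ hd hL b₀ b₁ Mstar) σ) + CTel d ℓ (trBasis N) ρ (CP * (((ℓ + 1 : ℕ) : ℝ)) * (B₀ * (((ℓ + 1 : ℕ) : ℝ))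 * ((cR39 (trBasis N))⁻¹ * (tJ * (((ℓ + 1 : ℕ) : ℝ)) ^ 2)) * rowConst261 (@geo9Y d ℓ hd hL b₀ b₁ Mstar) σ) * rowConst261 (@geo9Y d ℓ hd hL b₀ b₁ Mstar) σ) (CP * (((ℓ + 1 : ℕ) : ℝ)) * (B₀ * (((ℓ + 1 : ℕ) : ℝ)) * ((cR39 (trBasis N))⁻¹ * (tJ * (((ℓ + 1 : ℕ) : ℝ)) ^ 2)) * rowConst261 (@geo9Y d ℓ hd hL b₀ b₁ Mstar) σ) * rowConst261 (@geo9Y d ℓ hd hL b₀ b₁ Mstar) σ)) + (B43 * ((cR39 (trBasis N))⁻¹ * tA) * rowConst261 (@geo9Y d ℓ hd hL b₀ b₁ Mstar) σ + CTel d ℓ (trBasis N) ρ (CP * (((ℓ + 1 : ℕ) : ℝ)) * (B₀ * ((cR39 (trBasis N))⁻¹ * tA) * rowConst261 (@geo9Y d ℓ hd hL b₀ b₁ Mstar) σ) * rowConst261 (@geo9Y d ℓ hd hL b₀ b₁ Mstar) σ) (CP * (((ℓ + 1 : ℕ) : ℝ)) * (B₀ * ((cR39 (trBasis N))⁻¹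 * tA) * rowConst261 (@geo9Y d ℓ hd hL b₀ b₁ Mstar) σ) * rowConst261 (@geo9Y d ℓ hd hL b₀ b₁ Mstar) σ)) + (B43 * ((cR39 (trBasis N))⁻¹ * tA) * rowConst261 (@geo9Y d ℓ hd hL b₀ b₁ Mstar) σ + CTel d ℓ (trBasis N) ρ (CP * (((ℓ + 1 : ℕ) : ℝ)) * (B₀ * ((cR39 (trBasis N))⁻¹ * tA) * rowConst261 (@geo9Y d ℓ hd hL b₀ b₁ Mstar) σ) * rowConst261 (@geo9Y d ℓ hd hL b₀ b₁ Mstar) σ) (CP * (((ℓ + 1 : ℕ) : ℝ)) * (B₀ * ((cR39 (trBasis N))⁻¹ * tA) * rowConst261 (@geo9Y d ℓ hd hL b₀ b₁ Mstar) σ) * rowConst261 (@geo9Y d ℓ hd hL b₀ b₁ Mstar) σ))) ≤ t₂)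
    {Gp : ∀ x : MemberY d ℓ hd hL b₀ b₁ Mstar, SiteOpY (Matrix (Fin N) (Fin N) ℂ) x.toKIdx} (hGp : ∀ x : MemberY d ℓ hd hL b₀ b₁ Mstar, Gp x = GpY x.toKIdx (parT x.toKIdx))
    {parS : ∀ x : MemberY d ℓ hd hL b₀ b₁ Mstar, SiteParY (Matrix (Fin N) (Fin N) ℂ) x.toKIdx} (hparS : ∀ x : MemberY d ℓ hd hL b₀ b₁ Mstar, parS x = parT x.toKIdx)
    (h31 : ∀ x : MemberY d ℓ hd hL b₀ b₁ Mstar, M₀ ≤ (geo9Y x).M → ∀ α₀ : ℝ, 0 < α₀ → (geo9Y x).M * α₀ ≤ a₀ → ∀ U : (bg9YR (Matrix (Fin N) (Fin N) ℂ) (specialUnitaryUnits (Fin N)) R₁ R₂ x).Cfg, (bg9YR (Matrix (Fin N) (Fin N) ℂ) (specialUnitaryUnits (Fin N)) R₁ R₂ x).Reg335 c α₀ U →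
      Thm31GpMaj (g := geo9Y x) (blkSK x.toKIdx (sIK x.toKIdx (bI x))) (blkBK x.toKIdx (bI x))
        (GcoS x.toKIdx (trBasis N) (bg9YR (Matrix (Fin N) (Fin N) ℂ) (specialUnitaryUnits (Fin N)) R₁ R₂ x) (fun U => U) (Gp x) U)
        (DvcoKH x.toKIdx (trBasis N) (bg9YR (Matrix (Fin N) (Fin N) ℂ) (specialUnitaryUnits (Fin N)) R₁ R₂ x) (fun U => U) U) (DvscoKH x.toKIdx (trBasis N) (bg9YR (Matrix (Fin N) (Fin N) ℂ) (specialUnitaryUnits (Fin N)) R₁ R₂ x) (fun U => U) U) 1 (H x) B₀ δ₀)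
    (h49 : ∀ x : MemberY d ℓ hd hL b₀ b₁ Mstar, M₀ ≤ (geo9Y x).M → ∀ α₀ : ℝ, 0 < α₀ → (geo9Y x).M * α₀ ≤ a₀ → ∀ U : (bg9YR (Matrix (Fin N) (Fin N) ℂ) (specialUnitaryUnits (Fin N)) R₁ R₂ x).Cfg, (bg9YR (Matrix (Fin N) (Fin N) ℂ) (specialUnitaryUnits (Fin N)) R₁ R₂ x).Reg335 c α₀ U →
      Proj349Maj (g := geo9Y x) (blkSK x.toKIdx (sIK x.toKIdx (bI x))) (blkBK x.toKIdx (bI x))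
        (PcoK x.toKIdx (trBasis N) (bg9YR (Matrix (Fin N) (Fin N) ℂ) (specialUnitaryUnits (Fin N)) R₁ R₂ x) (fun U => U) (parS x) (Gp x) U)
        (DvcoKH x.toKIdx (trBasis N) (bg9YR (Matrix (Fin N) (Fin N) ℂ) (specialUnitaryUnits (Fin N)) R₁ R₂ x) (fun U => U) U) (DvscoKH x.toKIdx (trBasis N) (bg9YR (Matrix (Fin N) (Fin N) ℂ) (specialUnitaryUnits (Fin N)) R₁ R₂ x) (fun U => U) U) 1 (H x) CP δP)
    (h43 : ∀ x : MemberY d ℓ hd hL b₀ b₁ Mstar, letI : Fintype (geo9K x.toKIdx).Site := (inferInstance : Fintype (geo9Y x).Site); M₀ ≤ (geo9Y x).M → ∀ α₀ : ℝ, 0 < α₀ → (geo9Y x).M * α₀ ≤ a₀ → ∀ U : (bg9YR (Matrix (Fin N) (Fin N) ℂ) (specialUnitaryUnits (Fin N)) R₁ R₂ x).Cfg, (bg9YR (Matrix (Fin N) (Fin N) ℂ) (specialUnitaryUnits (Fin N)) R₁ R₂ x).Reg335 c α₀ U →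
      (bg9YR (Matrix (Fin N) (Fin N) ℂ) (specialUnitaryUnits (Fin N)) R₁ R₂ x).Reg336 c α₀ U →
        HasMaj (cNorm 1 (H x) (𝔬12 x).blk (fun y => (geo9Y_len_pos x y).le) 0) (bH13 x U)
          (GcoS x.toKIdx (trBasis N) (bg9YR (Matrix (Fin N) (Fin N) ℂ) (specialUnitaryUnits (Fin N)) R₁ R₂ x) (fun U => U) (GpY x.toKIdx (parT x.toKIdx)) U ∘ₗ DvscoKH x.toKIdx (trBasis N) (bg9YR (Matrix (Fin N) (Fin N) ℂ) (specialUnitaryUnits (Fin N)) R₁ R₂ x) (fun U => U) U)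
          (fun a a' => B43 * Real.exp (-(δ43 * (geo9Y x).dist a a'))))
:
    ∃ MT : ℝ, ∀ x : MemberY d ℓ hd hL b₀ b₁ Mstar, letI : Fintype (geo9K x.toKIdx).Site := (inferInstance : Fintype (geo9Y x).Site); MT ≤ (geo9Y x).M → ∀ α₀ : ℝ, 0 < α₀ → (geo9Y x).M * α₀ ≤ a₀ → ∀ U : (bg9YR (Matrix (Fin N) (Fin N) ℂ) (specialUnitaryUnits (Fin N)) R₁ R₂ x).Cfg, (bg9YR (Matrix (Fin N) (Fin N) ℂ) (specialUnitaryUnits (Fin N)) R₁ R₂ x).Reg335 c α₀ U →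
      (bg9YR (Matrix (Fin N) (Fin N) ℂ) (specialUnitaryUnits (Fin N)) R₁ R₂ x).Reg336 c α₀ U → CurrentMaj (𝔬12 x).blkW (𝔬12 x).blk (BcoKH x.toKIdx (trBasis N) (bg9YR (Matrix (Fin N) (Fin N) ℂ) (specialUnitaryUnits (Fin N)) R₁ R₂ x) (fun U => U) U) (BdcoKH x.toKIdx (trBasis N) (bg9YR (Matrix (Fin N) (Fin N) ℂ) (specialUnitaryUnits (Fin N)) R₁ R₂ x) (fun U => U) U) 1 (H x) (tJ * ((geo9Y x).M * α₀)) δB →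
      HasMaj (cNorm 1 (H x) (𝔬12 x).blk (fun y => (geo9Y_len_pos x y).le) 2) (cNorm 1 (H x) (𝔬12 x).blk (fun y => (geo9Y_len_pos x y).le) 0) (TaLcoK x.toKIdx (trBasis N) (bg9YR (Matrix (Fin N) (Fin N) ℂ) (specialUnitaryUnits (Fin N)) R₁ R₂ x) (fun U => U) (parT x.toKIdx) (GpPhysY x.toKIdx (parT x.toKIdx)) U) (fun a a' => tA * ((geo9Y x).M * α₀) * Real.exp (-(δT * (geo9Y x).dist a a'))) →
        HasMaj (cNorm 1 (H x) (𝔬12 x).blk (fun y => (geo9Y_len_pos x y).le) 2) (bH13 x U)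
          (TbLcoKH x.toKIdx (trBasis N) (bg9YR (Matrix (Fin N) (Fin N) ℂ) (specialUnitaryUnits (Fin N)) R₁ R₂ x) (fun U => U) (parT x.toKIdx) (GpPhysY x.toKIdx (parT x.toKIdx)) U)
          (fun a a' => t₂ * ((geo9Y x).M * α₀) * Real.exp (-(ρ * (geo9Y x).dist a a'))) := by
  obtain ⟨Mg, hFa⟩ := facts347_exp261_geo9Y (d := d) (ℓ := ℓ) (hd := hd) (hL := hL) (b₀ := b₀) (b₁ := b₁) (Mstar := Mstar) H (α := 1 / 2) (δ := 2 * τ)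
    (by norm_num) (by norm_num) (by linarith)
  obtain ⟨ML, hrow⟩ := rowConst261_spec_of_rowSum261 (rowSum261_geo9Y (d := d) (ℓ := ℓ) (hd := hd) (hL := hL) (b₀ := b₀) (b₁ := b₁) (Mstar := Mstar)) hσ
  have hc0 : (0 : ℝ) ≤ rowConst261 (@geo9Y d ℓ hd hL b₀ b₁ Mstar) σ := rowConst261_nonneg _ _
  have hτ' : 0 ≤ 1 / 2 * (2 * τ) := by linarith
  have hbud' : ρ + σ + 1 / 2 * (2 * τ) ≤ r := by linarith
  refine ⟨max M₀ (max Mg ML), fun x hM α₀ hα ha U hU hU' hBJx htax => ?_⟩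
  letI : Fintype (geo9K x.toKIdx).Site := (inferInstance : Fintype (geo9Y x).Site)
  have hM0 : M₀ ≤ (geo9Y x).M := (le_max_left _ _).trans hM
  have hrowx : RowSum (toB6 (geo9Y x) 1 (H x)) σ (rowConst261 (@geo9Y d ℓ hd hL b₀ b₁ Mstar) σ) := fun y => hrow x (((le_max_right _ _).trans (le_max_right _ _)).trans hM) y
  have hFax := hFa x (((le_max_left _ _).trans (le_max_right _ _)).trans hM)
  have hG : GeoOK (geo9Y x) := ⟨geo9Y_dist_triangle x, geo9Y_dist_comm x, geo9K_dist_nonneg x.toKIdx, geo9Y_len_pos x⟩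
  have hN : 0 < N := Nat.pos_of_ne_zero (NeZero.ne N)
  have hcR : 0 < cR39 (trBasis N) := cR39_trBasis_pos hN
  have hθ : 0 ≤ (geo9Y x).M * α₀ := mul_nonneg (hM₀.trans hM0) hα.le
  have h49' : Proj349Maj (𝔬12 x).blkW (𝔬12 x).blk
      (PcoK x.toKIdx (trBasis N) (bg9YR (Matrix (Fin N) (Fin N) ℂ) (specialUnitaryUnits (Fin N)) R₁ R₂ x) (fun U => U) (parT x.toKIdx) (GpY x.toKIdx (parT x.toKIdx)) U)
      (DvcoKH x.toKIdx (trBasis N) (bg9YR (Matrix (Fin N) (Fin N) ℂ) (specialUnitaryUnits (Fin N)) R₁ R₂ x) (fun U => U) U) (DvscoKH x.toKIdx (trBasis N) (bg9YR (Matrix (Fin N) (Fin N) ℂ) (specialUnitaryUnits (Fin N)) R₁ R₂ x) (fun U => U) U) 1 (H x) CP δP := by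
    rw [hblkW12 x, hblk12 x, ← hGp x, ← hparS x]
    exact h49 x hM0 α₀ hα ha U hU
  have h31' : Thm31GpMaj (𝔬12 x).blkW (𝔬12 x).blk (GcoS x.toKIdx (trBasis N) (bg9YR (Matrix (Fin N) (Fin N) ℂ) (specialUnitaryUnits (Fin N)) R₁ R₂ x) (fun U => U) (GpY x.toKIdx (parT x.toKIdx)) U)
      (DvcoKH x.toKIdx (trBasis N) (bg9YR (Matrix (Fin N) (Fin N) ℂ) (specialUnitaryUnits (Fin N)) R₁ R₂ x) (fun U => U) U) (DvscoKH x.toKIdx (trBasis N) (bg9YR (Matrix (Fin N) (Fin N) ℂ) (specialUnitaryUnits (Fin N)) R₁ R₂ x) (fun U => U) U) 1 (H x) B₀ δ₀ := by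
    rw [hblkW12 x, hblk12 x, ← hGp x]
    exact h31 x hM0 α₀ hα ha U hU
  have h43x := h43 x hM0 α₀ hα ha U hU hU'
  rw [hbH13 x U] at h43x ⊢
  have h31'' := h31'; have h49'' := h49'
  rw [hblkW12 x, hblk12 x] at h31'' h49'' hBJx
  rw [hblk12 x] at h43x htax
  have h := tbH_pins_print_of_h43 x.toKIdx (trBasis N) (bg9YR (Matrix (Fin N) (Fin N) ℂ) (specialUnitaryUnits (Fin N)) R₁ R₂ x) (fun U => U) (parT x.toKIdx)
    w13 hw13₀ hw13₁ hG hFax hrowx hcR (hβ1 x) (hlev x) (abs_cf_eq_nKT x.toKIdx x.hcfk) (links_le_one hGR x hU) h31'' h49'' hBJx h43x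
    htax hB₀ hCP htJ hθ hB43 htA hc0 hσ.le hτ' hr₀ hrP hrB hρ hρT hbud' hbud43
  rw [← hblk12 x] at h
  -- the member's `L ≤ ℓ + 1` into the closed constant (the two fields separately, `hasMaj_weaken` at the same rate)
  have hLx : (geo9Y x).L ≤ (((ℓ + 1 : ℕ) : ℝ)) := (geo9Y_scalars x).2.1
  have hL0 : 0 ≤ (geo9Y x).L := le_trans zero_le_one hFax.one_le_L
  have hi : 0 ≤ (cR39 (trBasis N))⁻¹ := inv_nonneg.2 hcR.le
  have hJ0 : 0 ≤ (B₀ * (geo9Y x).L * ((cR39 (trBasis N))⁻¹ * (tJ * (geo9Y x).L ^ 2)) * rowConst261 (@geo9Y d ℓ hd hL b₀ b₁ Mstar) σ) := by positivity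
  have hJJ : (B₀ * (geo9Y x).L * ((cR39 (trBasis N))⁻¹ * (tJ * (geo9Y x).L ^ 2)) * rowConst261 (@geo9Y d ℓ hd hL b₀ b₁ Mstar) σ) ≤ (B₀ * (((ℓ + 1 : ℕ) : ℝ)) * ((cR39 (trBasis N))⁻¹ * (tJ * (((ℓ + 1 : ℕ) : ℝ)) ^ 2)) * rowConst261 (@geo9Y d ℓ hd hL b₀ b₁ Mstar) σ) := by gcongr
  have hKJ0 : 0 ≤ (CP * (geo9Y x).L * (B₀ * (geo9Y x).L * ((cR39 (trBasis N))⁻¹ * (tJ * (geo9Y x).L ^ 2)) * rowConst261 (@geo9Y d ℓ hd hL b₀ b₁ Mstar) σ) * rowConst261 (@geo9Y d ℓ hd hL b₀ b₁ Mstar) σ) := by positivity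
  have hKJJ : (CP * (geo9Y x).L * (B₀ * (geo9Y x).L * ((cR39 (trBasis N))⁻¹ * (tJ * (geo9Y x).L ^ 2)) * rowConst261 (@geo9Y d ℓ hd hL b₀ b₁ Mstar) σ) * rowConst261 (@geo9Y d ℓ hd hL b₀ b₁ Mstar) σ) ≤ (CP * (((ℓ + 1 : ℕ) : ℝ)) * (B₀ * (((ℓ + 1 : ℕ) : ℝ)) * ((cR39 (trBasis N))⁻¹ * (tJ * (((ℓ + 1 : ℕ) : ℝ)) ^ 2)) * rowConst261 (@geo9Y d ℓ hd hL b₀ b₁ Mstar) σ) * rowConst261 (@geo9Y d ℓ hd hL b₀ b₁ Mstar) σ) := by gcongr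
  have hK0 : 0 ≤ (CP * (geo9Y x).L * (B₀ * ((cR39 (trBasis N))⁻¹ * tA) * rowConst261 (@geo9Y d ℓ hd hL b₀ b₁ Mstar) σ) * rowConst261 (@geo9Y d ℓ hd hL b₀ b₁ Mstar) σ) := by positivity
  have hKK : (CP * (geo9Y x).L * (B₀ * ((cR39 (trBasis N))⁻¹ * tA) * rowConst261 (@geo9Y d ℓ hd hL b₀ b₁ Mstar) σ) * rowConst261 (@geo9Y d ℓ hd hL b₀ b₁ Mstar) σ) ≤ (CP * (((ℓ + 1 : ℕ) : ℝ)) * (B₀ * ((cR39 (trBasis N))⁻¹ * tA) * rowConst261 (@geo9Y d ℓ hd hL b₀ b₁ Mstar) σ) * rowConst261 (@geo9Y d ℓ hd hL b₀ b₁ Mstar) σ) := by gcongr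
  have hKHle : ((CTel d ℓ (trBasis N) ρ (B₀ * (geo9Y x).L * ((cR39 (trBasis N))⁻¹ * (tJ * (geo9Y x).L ^ 2)) * rowConst261 (@geo9Y d ℓ hd hL b₀ b₁ Mstar) σ) (B₀ * (geo9Y x).L * ((cR39 (trBasis N))⁻¹ * (tJ * (geo9Y x).L ^ 2)) * rowConst261 (@geo9Y d ℓ hd hL b₀ b₁ Mstar) σ) + CTel d ℓ (trBasis N) ρ (CP * (geo9Y x).L * (B₀ * (geo9Y x).L * ((cR39 (trBasis N))⁻¹ * (tJ * (geo9Y x).L ^ 2)) * rowConst261 (@geo9Y d ℓ hd hL b₀ b₁ Mstar) σ) * rowConst261 (@geo9Y d ℓ hd hL b₀ b₁ Mstar) σ) (CP * (geo9Y x).L * (B₀ * (geo9Y x).L * ((cR39 (trBasis N))⁻¹ * (tJ * (geo9Y x).L ^ 2)) * rowConst261 (@geo9Y d ℓ hd hL b₀ b₁ Mstar) σ) * rowConst261 (@geo9Y d ℓ hd hL b₀ b₁ Mstar) σ)) + (B43 * ((cR39 (trBasis N))⁻¹ * tA) * rowConst261 (@geo9Y d ℓ hd hL b₀ b₁ Mstar)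 σ + CTel d ℓ (trBasis N) ρ (CP * (geo9Y x).L * (B₀ * ((cR39 (trBasis N))⁻¹ * tA) * rowConst261 (@geo9Y d ℓ hd hL b₀ b₁ Mstar) σ) * rowConst261 (@geo9Y d ℓ hd hL b₀ b₁ Mstar) σ) (CP * (geo9Y x).L * (B₀ * ((cR39 (trBasis N))⁻¹ * tA) * rowConst261 (@geo9Y d ℓ hd hL b₀ b₁ Mstar) σ) * rowConst261 (@geo9Y d ℓ hd hL b₀ b₁ Mstar) σ)) + (B43 * ((cR39 (trBasis N))⁻¹ * tA) * rowConst261 (@geo9Y d ℓ hd hL b₀ b₁ Mstar) σ + CTel d ℓ (trBasis N) ρ (CP * (geo9Y x).L * (B₀ * ((cR39 (trBasis N))⁻¹ * tA) * rowConst261 (@geo9Y d ℓ hd hL b₀ b₁ Mstar) σ) * rowConst261 (@geo9Y d ℓ hd hL b₀ b₁ Mstar) σ) (CP * (geo9Y x).L * (B₀ * ((cR39 (trBasis N))⁻¹ * tA) * rowConst261 (@geo9Y d ℓ hd hL b₀ b₁ Mstar) σ) * rowConst261 (@geo9Y d ℓ hd hL b₀ b₁ Mstar) σ))) * ((geo9Y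 x).M * α₀) ≤ ((CTel d ℓ (trBasis N) ρ (B₀ * (((ℓ + 1 : ℕ) : ℝ)) * ((cR39 (trBasis N))⁻¹ * (tJ * (((ℓ + 1 : ℕ) : ℝ)) ^ 2)) * rowConst261 (@geo9Y d ℓ hd hL b₀ b₁ Mstar) σ) (B₀ * (((ℓ + 1 : ℕ) : ℝ)) * ((cR39 (trBasis N))⁻¹ * (tJ * (((ℓ + 1 : ℕ) : ℝ)) ^ 2)) * rowConst261 (@geo9Y d ℓ hd hL b₀ b₁ Mstar) σ) + CTel d ℓ (trBasis N) ρ (CP * (((ℓ + 1 : ℕ) : ℝ)) * (B₀ * (((ℓ + 1 : ℕ) : ℝ)) * ((cR39 (trBasis N))⁻¹ * (tJ * (((ℓ + 1 : ℕ) : ℝ)) ^ 2)) * rowConst261 (@geo9Y d ℓ hd hL b₀ b₁ Mstar) σ) * rowConst261 (@geo9Y d ℓ hd hL b₀ b₁ Mstar) σ) (CP * (((ℓ + 1 : ℕ) : ℝ)) * (B₀ * (((ℓ + 1 : ℕ) : ℝ)) * ((cR39 (trBasis N))⁻¹ * (tJ * (((ℓ + 1 : ℕ) : ℝ)) ^ 2))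 * rowConst261 (@geo9Y d ℓ hd hL b₀ b₁ Mstar) σ) * rowConst261 (@geo9Y d ℓ hd hL b₀ b₁ Mstar) σ)) + (B43 * ((cR39 (trBasis N))⁻¹ * tA) * rowConst261 (@geo9Y d ℓ hd hL b₀ b₁ Mstar) σ + CTel d ℓ (trBasis N) ρ (CP * (((ℓ + 1 : ℕ) : ℝ)) * (B₀ * ((cR39 (trBasis N))⁻¹ * tA) * rowConst261 (@geo9Y d ℓ hd hL b₀ b₁ Mstar) σ) * rowConst261 (@geo9Y d ℓ hd hL b₀ b₁ Mstar) σ) (CP * (((ℓ + 1 : ℕ) : ℝ)) * (B₀ * ((cR39 (trBasis N))⁻¹ * tA) * rowConst261 (@geo9Y d ℓ hd hL b₀ b₁ Mstar) σ) * rowConst261 (@geo9Y d ℓ hd hL b₀ b₁ Mstar) σ)) + (B43 * ((cR39 (trBasis N))⁻¹ * tA) * rowConst261 (@geo9Y d ℓ hd hL b₀ b₁ Mstar) σ + CTel d ℓ (trBasis N) ρ (CP * (((ℓ + 1 : ℕ) : ℝ)) * (B₀ * ((cR39 (trBasis N))⁻¹ * tA) * rowConst261 (@geo9Y d ℓ hd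 hL b₀ b₁ Mstar) σ) * rowConst261 (@geo9Y d ℓ hd hL b₀ b₁ Mstar) σ) (CP * (((ℓ + 1 : ℕ) : ℝ)) * (B₀ * ((cR39 (trBasis N))⁻¹ * tA) * rowConst261 (@geo9Y d ℓ hd hL b₀ b₁ Mstar) σ) * rowConst261 (@geo9Y d ℓ hd hL b₀ b₁ Mstar) σ))) * ((geo9Y x).M * α₀) := by
    apply mul_le_mul_of_nonneg_right _ hθ
    have h1 := CTel_mono (d := d) (ℓ := ℓ) (trBasis N) (δ := ρ) hJJ hJJ
    have h2 := CTel_mono (d := d) (ℓ := ℓ) (trBasis N) (δ := ρ) hKJJ hKJJ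
    have h3 := CTel_mono (d := d) (ℓ := ℓ) (trBasis N) (δ := ρ) hKK hKK
    linarith
  have hKHnn : 0 ≤ ((CTel d ℓ (trBasis N) ρ (B₀ * (geo9Y x).L * ((cR39 (trBasis N))⁻¹ * (tJ * (geo9Y x).L ^ 2)) * rowConst261 (@geo9Y d ℓ hd hL b₀ b₁ Mstar) σ) (B₀ * (geo9Y x).L * ((cR39 (trBasis N))⁻¹ * (tJ * (geo9Y x).L ^ 2)) * rowConst261 (@geo9Y d ℓ hd hL b₀ b₁ Mstar) σ) + CTel d ℓ (trBasis N) ρ (CP * (geo9Y x).L * (B₀ * (geo9Y x).L * ((cR39 (trBasis N))⁻¹ * (tJ * (geo9Y x).L ^ 2)) * rowConst261 (@geo9Y d ℓ hd hL b₀ b₁ Mstar) σ) * rowConst261 (@geo9Y d ℓ hd hL b₀ b₁ Mstar) σ) (CP * (geo9Y x).L * (B₀ * (geo9Y x).L * ((cR39 (trBasis N))⁻¹ * (tJ * (geo9Y x).L ^ 2)) * rowConst261 (@geo9Y d ℓ hd hL b₀ b₁ Mstar) σ) * rowConst261 (@geo9Y d ℓ hd hL b₀ b₁ Mstar) σ))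 + (B43 * ((cR39 (trBasis N))⁻¹ * tA) * rowConst261 (@geo9Y d ℓ hd hL b₀ b₁ Mstar) σ + CTel d ℓ (trBasis N) ρ (CP * (geo9Y x).L * (B₀ * ((cR39 (trBasis N))⁻¹ * tA) * rowConst261 (@geo9Y d ℓ hd hL b₀ b₁ Mstar) σ) * rowConst261 (@geo9Y d ℓ hd hL b₀ b₁ Mstar) σ) (CP * (geo9Y x).L * (B₀ * ((cR39 (trBasis N))⁻¹ * tA) * rowConst261 (@geo9Y d ℓ hd hL b₀ b₁ Mstar) σ) * rowConst261 (@geo9Y d ℓ hd hL b₀ b₁ Mstar) σ)) + (B43 * ((cR39 (trBasis N))⁻¹ * tA) * rowConst261 (@geo9Y d ℓ hd hL b₀ b₁ Mstar) σ + CTel d ℓ (trBasis N) ρ (CP * (geo9Y x).L * (B₀ * ((cR39 (trBasis N))⁻¹ * tA) * rowConst261 (@geo9Y d ℓ hd hL b₀ b₁ Mstar) σ) * rowConst261 (@geo9Y d ℓ hd hL b₀ b₁ Mstar) σ) (CP * (geo9Y x).L * (B₀ * ((cR39 (trBasis N))⁻¹ * tA) * rowConst261 (@geo9Y d ℓ hd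 hL b₀ b₁ Mstar) σ) * rowConst261 (@geo9Y d ℓ hd hL b₀ b₁ Mstar) σ))) * ((geo9Y x).M * α₀) := by
    have h1 := CTel_nonneg (d := d) (ℓ := ℓ) (trBasis N) (δ := ρ) hJ0 hJ0
    have h2 := CTel_nonneg (d := d) (ℓ := ℓ) (trBasis N) (δ := ρ) hKJ0 hKJ0
    have h3 := CTel_nonneg (d := d) (ℓ := ℓ) (trBasis N) (δ := ρ) hK0 hK0
    have h4 : 0 ≤ B43 * ((cR39 (trBasis N))⁻¹ * tA) * rowConst261 (@geo9Y d ℓ hd hL b₀ b₁ Mstar) σ := by positivity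
    positivity
  have ht₂θ := hKHle.trans (mul_le_mul_of_nonneg_right ht₂ hθ)
  have hX0 : 0 ≤ B43 * ((cR39 (trBasis N))⁻¹ * tA) * rowConst261 (@geo9Y d ℓ hd hL b₀ b₁ Mstar) σ + CTel d ℓ (trBasis N) ρ (CP * (geo9Y x).L * (B₀ * ((cR39 (trBasis N))⁻¹ * tA) * rowConst261 (@geo9Y d ℓ hd hL b₀ b₁ Mstar) σ) * rowConst261 (@geo9Y d ℓ hd hL b₀ b₁ Mstar) σ) (CP * (geo9Y x).L * (B₀ * ((cR39 (trBasis N))⁻¹ * tA) * rowConst261 (@geo9Y d ℓ hd hL b₀ b₁ Mstar) σ) * rowConst261 (@geo9Y d ℓ hd hL b₀ b₁ Mstar) σ) := by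
    have h3 := CTel_nonneg (d := d) (ℓ := ℓ) (trBasis N) (δ := ρ) hK0 hK0
    positivity
  have hK1nn : 0 ≤ ((CTel d ℓ (trBasis N) ρ (B₀ * (geo9Y x).L * ((cR39 (trBasis N))⁻¹ * (tJ * (geo9Y x).L ^ 2)) * rowConst261 (@geo9Y d ℓ hd hL b₀ b₁ Mstar) σ) (B₀ * (geo9Y x).L * ((cR39 (trBasis N))⁻¹ * (tJ * (geo9Y x).L ^ 2)) * rowConst261 (@geo9Y d ℓ hd hL b₀ b₁ Mstar) σ) + CTel d ℓ (trBasis N) ρ (CP * (geo9Y x).L * (B₀ * (geo9Y x).L * ((cR39 (trBasis N))⁻¹ * (tJ * (geo9Y x).L ^ 2)) * rowConst261 (@geo9Y d ℓ hd hL b₀ b₁ Mstar) σ) * rowConst261 (@geo9Y d ℓ hd hL b₀ b₁ Mstar) σ) (CP * (geo9Y x).L * (B₀ * (geo9Y x).L * ((cR39 (trBasis N))⁻¹ * (tJ * (geo9Y x).L ^ 2)) * rowConst261 (@geo9Y d ℓ hd hL b₀ b₁ Mstar) σ) * rowConst261 (@geo9Y d ℓ hd hL b₀ b₁ Mstar)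 σ)) + (B43 * ((cR39 (trBasis N))⁻¹ * tA) * rowConst261 (@geo9Y d ℓ hd hL b₀ b₁ Mstar) σ + CTel d ℓ (trBasis N) ρ (CP * (geo9Y x).L * (B₀ * ((cR39 (trBasis N))⁻¹ * tA) * rowConst261 (@geo9Y d ℓ hd hL b₀ b₁ Mstar) σ) * rowConst261 (@geo9Y d ℓ hd hL b₀ b₁ Mstar) σ) (CP * (geo9Y x).L * (B₀ * ((cR39 (trBasis N))⁻¹ * tA) * rowConst261 (@geo9Y d ℓ hd hL b₀ b₁ Mstar) σ) * rowConst261 (@geo9Y d ℓ hd hL b₀ b₁ Mstar) σ))) * ((geo9Y x).M * α₀) := by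
    have h1 := CTel_nonneg (d := d) (ℓ := ℓ) (trBasis N) (δ := ρ) hJ0 hJ0
    have h2 := CTel_nonneg (d := d) (ℓ := ℓ) (trBasis N) (δ := ρ) hKJ0 hKJ0
    positivity
  have hK1le := (mul_le_mul_of_nonneg_right (le_add_of_nonneg_right hX0) hθ).trans ht₂θ
  exact hasMaj_weaken hG hK1nn hK1le le_rfl h

end Summit.QuantumFields.YangMills.BalabanUVNodes.N06TbHLegAtPinsPhysPUPar
end
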